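import Summits.QuantumAdvantage.AdviceFreeQNC0.BlockPathExpansion
import Summits.QuantumAdvantage.AdviceFreeQNC0.BlockLemmaQuant
import HarnessLib

/-!
# Cell qa-qnc0, `p = 3` — the UNIFORM BLOCK NORM `(2+√3)/4`: `BlockNormUniform3` PROVED

Planner qa-qnc0-p1 g20 typed the CONJECTURE `BondTwist3.BlockNormUniform3` (`BondTwistLocal.lean` §8; numerics kit j297011, ROUND-19 §3):
for every radius `r`, every primitive cube root `ζ`, all unimodular later phases `ω` and all sign patterns `ε`, the block operator
`T_ζ ∘ T_{ω₀} ∘ ⋯ ∘ T_{ω_{2r−1}}` of the register chain satisfies `‖T f‖² ≤ (2+√3)/4 · ‖f‖²` — the worst block is `r`-INDEPENDENT.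
This file proves it: **`blockNormUniform3 : BlockNormUniform3`**.

## Proof
Path expansion (`chainOp_eq_sum`): `(T f)(σ) = 2^{−(2r+1)} Σ_{b,w} ζ^{b}·Φ_w·(±1)·f(σ·(b,w))`.  After `2r + 1` letters the register is
flushed, so the end state `σ·(b,w)` depends on `σ = (P, s, reg)` only through `(P, s)` (`run_reg_irrel`), and the SWAP `run_false_cons`:
`(P,s,reg)·(0,w) = (P,¬s,reg)·(1,w)`.  Hence the two states `σ_T = (P,⊤,reg)`, `σ_F = (P,⊥,reg)` are two unimodular functionals
`c_T, c_F` of the SAME vector `g(b,w) = f((P + spinZ b, b, ·)·w)` on `ι = Bool × {0,1}^{2r}` (`|ι| = 2·4^r`), whose Gram product is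
`Σ c_T c̄_F = ζ·A + ζ̄·B` with `A, B` REAL sums of `4^r` signs (`±1`: all signs and `|Φ_w|² = 1` are real); since `Re ζ² = −1/2`,
`|ζA + ζ̄B|² = A² + B² − AB ≤ 3·16^r`.  The two-functional Gram lemma (`gram_two`:
`|c_T·g|² + |c_F·g|² ≤ (|ι| + |Σ c_T c̄_F|)·‖g‖²`) gives `(2 + √3)·4^r·‖g‖²` per pair; summing over `(P, reg)` and re-indexing by the
end-state bijection (`sum_run_eq`) gives `Σ_{P,reg} ‖g‖² = 4^r ‖f‖²`, whence `‖Tf‖² ≤ 4^{−(2r+1)}(2+√3)·16^r‖f‖² = (2+√3)/4·‖f‖²`.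
(For `r = 0` this is the elementary `2 × 2` computation `sup = (2 + |ζ − ζ̄|)/4`.)

Consequence (not drawn here): the radius dependence of `TwistBoundX3LocalQ` / `TwistBoundStateLocalQ` improves from `(2r+1)^{−3}` to the
per-block rate `((2+√3)/4)^{1/2}` uniformly in `r` (p2 g36's Θ(wt/r) prediction).

WHAT THIS IS NOT: crux 22907 untouched; no separation.
-/

noncomputable section

namespace Summit.QuantumAdvantage.AdviceFreeQNC0

open Finset Literature.Computability.QuantumComplexity

namespace BondTwist3

open scoped ComplexConjugate

variable {r : ℕ}

/-! ## The two-functional Gram lemma -/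

/-- **Gram lemma for two unimodular functionals**: `|Σ cᵢgᵢ|² + |Σ dᵢgᵢ|² ≤ (|ι| + |Σ cᵢ d̄ᵢ|)·Σ|gᵢ|²`. -/
theorem gram_two {ι : Type*} [Fintype ι] (c d g : ι → ℂ) (hc : ∀ i, ‖c i‖ = 1) (hd : ∀ i, ‖d i‖ = 1) :
    ‖∑ i, c i * g i‖ ^ 2 + ‖∑ i, d i * g i‖ ^ 2 ≤
      ((Fintype.card ι : ℝ) + ‖∑ i, c i * conj (d i)‖) * ∑ i, ‖g i‖ ^ 2 := by
  obtain ⟨a, ha⟩ : ∃ a : ℂ, a = ∑ i, c i * g i := ⟨_, rfl⟩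
  obtain ⟨b, hb⟩ : ∃ b : ℂ, b = ∑ i, d i * g i := ⟨_, rfl⟩
  obtain ⟨γ, hγ⟩ : ∃ γ : ℂ, γ = ∑ i, c i * conj (d i) := ⟨_, rfl⟩
  rw [← ha, ← hb, ← hγ]
  set S : ℝ := ‖a‖ ^ 2 + ‖b‖ ^ 2 with hS
  set G : ℝ := ∑ i, ‖g i‖ ^ 2 with hG
  set v : ι → ℂ := fun i => conj a * c i + conj b * d i with hv
  have hS0 : 0 ≤ S := by positivity
  have hG0 : 0 ≤ G := by positivity
  -- `S = Re Σ vᵢ gᵢ`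
  have h1 : (S : ℝ) = (∑ i, v i * g i).re := by
    have e : ∑ i, v i * g i = conj a * a + conj b * b := by
      simp only [hv, add_mul, Finset.sum_add_distrib, mul_assoc, ← Finset.mul_sum, ← ha, ← hb]
    rw [e, Complex.add_re]
    have ha2 : (conj a * a).re = ‖a‖ ^ 2 := by rw [Complex.conj_mul']; norm_cast
    have hb2 : (conj b * b).re = ‖b‖ ^ 2 := by rw [Complex.conj_mul']; norm_cast
    rw [ha2, hb2]
  -- `Re Σ vᵢgᵢ ≤ Σ ‖vᵢ‖‖gᵢ‖ ≤ √(Σ‖v‖²) √G`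
  have h2 : S ≤ ∑ i, ‖v i‖ * ‖g i‖ := by
    rw [h1]
    refine (Complex.re_le_norm _).trans ((norm_sum_le _ _).trans (Finset.sum_le_sum fun i _ => ?_))
    rw [norm_mul]
  have h3 : (∑ i, ‖v i‖ * ‖g i‖) ^ 2 ≤ (∑ i, ‖v i‖ ^ 2) * G := Finset.sum_mul_sq_le_sq_mul_sq _ _ _
  -- `Σ ‖vᵢ‖² ≤ (N + ‖γ‖)·S`
  have h4 : ∑ i, ‖v i‖ ^ 2 ≤ ((Fintype.card ι : ℝ) + ‖γ‖) * S := by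
    have hterm : ∀ i, ‖v i‖ ^ 2 = S + 2 * (conj a * b * (c i * conj (d i))).re := by
      intro i
      rw [← Complex.normSq_eq_norm_sq]
      simp only [hv]
      rw [Complex.normSq_add, Complex.normSq_mul, Complex.normSq_mul, Complex.normSq_conj, Complex.normSq_conj,
        Complex.normSq_eq_norm_sq, Complex.normSq_eq_norm_sq, Complex.normSq_eq_norm_sq, Complex.normSq_eq_norm_sq,
        hc i, hd i]
      have e : conj a * c i * conj (conj b * d i) = conj a * b * (c i * conj (d i)) := by
        rw [map_mul, Complex.conj_conj]; ring
      rw [e, hS]; ring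
    rw [Finset.sum_congr rfl fun i _ => hterm i, Finset.sum_add_distrib, Finset.sum_const, Finset.card_univ, nsmul_eq_mul,
      ← Finset.mul_sum]
    have hre : ∑ i, (conj a * b * (c i * conj (d i))).re = (conj a * b * γ).re := by
      rw [hγ, Finset.mul_sum, Complex.re_sum]
    rw [hre]
    have h5 : (conj a * b * γ).re ≤ ‖a‖ * ‖b‖ * ‖γ‖ := by
      refine (Complex.re_le_norm _).trans ?_
      rw [norm_mul, norm_mul, Complex.norm_conj]
    have h6 : 2 * (‖a‖ * ‖b‖) ≤ S := by rw [hS]; nlinarith [sq_nonneg (‖a‖ - ‖b‖)]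
    have hγ0 : 0 ≤ ‖γ‖ := norm_nonneg _
    nlinarith
  -- conclude
  have h7 : S ^ 2 ≤ ((Fintype.card ι : ℝ) + ‖γ‖) * S * G := by
    have hv0 : 0 ≤ ∑ i, ‖v i‖ * ‖g i‖ := Finset.sum_nonneg fun i _ => by positivity
    calc S ^ 2 ≤ (∑ i, ‖v i‖ * ‖g i‖) ^ 2 := pow_le_pow_left₀ hS0 h2 2
      _ ≤ (∑ i, ‖v i‖ ^ 2) * G := h3
      _ ≤ ((Fintype.card ι : ℝ) + ‖γ‖) * S * G := mul_le_mul_of_nonneg_right h4 hG0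
  have hK : 0 ≤ ((Fintype.card ι : ℝ) + ‖γ‖) * G := by positivity
  by_cases hSz : S = 0
  · rw [hSz]; exact hK
  · have hSpos : 0 < S := lt_of_le_of_ne hS0 (Ne.symm hSz)
    nlinarith

/-! ## Cube roots -/

/-- For a primitive cube root: `Re ζ² = −1/2` and `conj ζ = ζ²`. -/
theorem cube_root_facts {ζ : ℂ} (hζ3 : ζ ^ 3 = 1) (hζ1 : ζ ≠ 1) : (ζ ^ 2).re = -1 / 2 ∧ conj ζ = ζ ^ 2 := by
  have hsum := cube_root_sum hζ3 hζ1
  have hn : ‖ζ‖ = 1 := norm_eq_one_of_cube hζ3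
  have hconj : conj ζ = ζ ^ 2 := by
    have hinv : ζ⁻¹ = conj ζ := (Complex.inv_eq_conj hn)
    have hne : ζ ≠ 0 := fun h => by rw [h, norm_zero] at hn; exact zero_ne_one hn
    rw [← hinv]
    have : ζ * ζ ^ 2 = 1 := by rw [← pow_succ']; exact hζ3
    exact (eq_inv_of_mul_eq_one_right this).symm ▸ rfl
  refine ⟨?_, hconj⟩
  -- `Re ζ² = Re conj ζ = Re ζ`, and `ζ² = −1 − ζ`
  have h1 : (ζ ^ 2).re = ζ.re := by rw [← hconj, Complex.conj_re]
  have h2 : ζ ^ 2 = -1 - ζ := by linear_combination hsum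
  have h3 : (ζ ^ 2).re = -1 - ζ.re := by rw [h2]; simp
  linarith

/-- `|ζ A + ζ̄ B| ≤ √3 · M` for REAL `A, B` with `|A|, |B| ≤ M` (`M ≥ 0`). -/
theorem norm_zeta_real_combo {ζ : ℂ} (hζ3 : ζ ^ 3 = 1) (hζ1 : ζ ≠ 1) (A B M : ℝ) (hM : 0 ≤ M)
    (hA : |A| ≤ M) (hB : |B| ≤ M) : ‖ζ * A + conj ζ * B‖ ≤ Real.sqrt 3 * M := by
  obtain ⟨hre, hconj⟩ := cube_root_facts hζ3 hζ1
  have hn : ‖ζ‖ = 1 := norm_eq_one_of_cube hζ3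
  have hsq : ‖ζ * A + conj ζ * B‖ ^ 2 = A ^ 2 + B ^ 2 - A * B := by
    rw [← Complex.normSq_eq_norm_sq, Complex.normSq_add, Complex.normSq_mul, Complex.normSq_mul, Complex.normSq_conj,
      Complex.normSq_eq_norm_sq, hn, Complex.normSq_ofReal, Complex.normSq_ofReal]
    have e : ζ * A * conj (conj ζ * B) = ζ ^ 2 * (A * B : ℝ) := by
      rw [map_mul, Complex.conj_conj, Complex.conj_ofReal]; push_cast; ring
    rw [e, Complex.re_mul_ofReal, hre]
    ring
  have h3 : A ^ 2 + B ^ 2 - A * B ≤ 3 * M ^ 2 := by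
    have hA2 : A ^ 2 ≤ M ^ 2 := by nlinarith [abs_nonneg A, sq_abs A]
    have hB2 : B ^ 2 ≤ M ^ 2 := by nlinarith [abs_nonneg B, sq_abs B]
    have hAB : -(A * B) ≤ M ^ 2 := by
      have : |A * B| ≤ M * M := by rw [abs_mul]; exact mul_le_mul hA hB (abs_nonneg _) hM
      have := neg_abs_le (A * B)
      nlinarith
    linarith
  have hle : ‖ζ * A + conj ζ * B‖ ^ 2 ≤ (Real.sqrt 3 * M) ^ 2 := by
    rw [hsq, mul_pow, Real.sq_sqrt (by norm_num)]; linarith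
  exact abs_le_of_sq_le_sq' hle (by positivity) |>.2

/-- A sum of `±1`'s is bounded by the number of terms. -/
theorem abs_sum_pm_le {ι : Type*} [Fintype ι] (θ : ι → ℝ) (h : ∀ i, θ i = 1 ∨ θ i = -1) :
    |∑ i, θ i| ≤ Fintype.card ι := by
  refine (Finset.abs_sum_le_sum_abs _ _).trans ?_
  have : ∀ i, |θ i| = 1 := fun i => by rcases h i with e | e <;> rw [e] <;> simp
  simp [this]

/-! ## The block operator, unfolded -/

/-- The inner chain of a block: phases `ω`, signs `ε (j+1)`. -/
def innerChain (ω : Fin (2 * r) → ℂ) (ε : Fin (2 * r + 1) → RegState r → Bool → Bool) :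
    List (ℂ × (RegState r → Bool → Bool)) :=
  List.ofFn fun j : Fin (2 * r) => (ω j, ε j.succ)

/-- The inner chain has length `2r`. -/
theorem length_innerChain (ω : Fin (2 * r) → ℂ) (ε : Fin (2 * r + 1) → RegState r → Bool → Bool) :
    (innerChain ω ε).length = 2 * r := by
  simp [innerChain]

/-- The inner chain has unimodular phases if `ω` does. -/
theorem innerChain_unimodular {ω : Fin (2 * r) → ℂ} (hω : ∀ j, ‖ω j‖ = 1)
    (ε : Fin (2 * r + 1) → RegState r → Bool → Bool) : ∀ p ∈ innerChain ω ε, ‖p.1‖ = 1 := by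
  intro p hp
  simp only [innerChain, List.mem_ofFn] at hp
  obtain ⟨j, rfl⟩ := hp
  exact hω j

/-- The block operator: first site `ζ, ε 0`, then the inner chain. -/
theorem blockOpR_apply (ζ : ℂ) (ω : Fin (2 * r) → ℂ) (ε : Fin (2 * r + 1) → RegState r → Bool → Bool)
    (f : RegState r → ℂ) (σ : RegState r) :
    blockOpR ζ ω ε f σ = ((if ε 0 σ false then (-1 : ℂ) else 1) * chainOp (innerChain ω ε) f (nextState σ false) +
      ζ * (if ε 0 σ true then (-1 : ℂ) else 1) * chainOp (innerChain ω ε) f (nextState σ true)) / 2 := rfl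

/-! ## The pair estimate -/

section Pair

variable {ζ : ℂ} (hζ3 : ζ ^ 3 = 1) (hζ1 : ζ ≠ 1) {ω : Fin (2 * r) → ℂ} (hω : ∀ j, ‖ω j‖ = 1)
  (ε : Fin (2 * r + 1) → RegState r → Bool → Bool) (f : RegState r → ℂ)

/-- The common vector of the pair `(P, ⊤, reg)`, `(P, ⊥, reg)`: end states indexed by first letter and inner word. -/
def gVec (f : RegState r → ℂ) (P : ZMod 3) (x : Bool × (Fin (2 * r) → Bool)) : ℂ :=
  f (run ((P + spinZ x.1, x.1, fun _ => false) : RegState r) (List.ofFn x.2))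

/-- The functional of the state `(P, s, reg)`: first letter `b = [s = x.1] `… concretely, the path `(s·?)` reaching index `x`. -/
def cVec (ζ : ℂ) (ω : Fin (2 * r) → ℂ) (ε : Fin (2 * r + 1) → RegState r → Bool → Bool) (P : ZMod 3) (s : Bool)
    (reg : Fin (2 * r) → Bool) (x : Bool × (Fin (2 * r) → Bool)) : ℂ :=
  if x.1 = s then
    ζ * (if ε 0 (P, s, reg) true then (-1 : ℂ) else 1) *
      (phaseProd (innerChain ω ε) (List.ofFn x.2) * pathSgn (innerChain ω ε) (nextState (P, s, reg) true) (List.ofFn x.2))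
  else
    (if ε 0 (P, s, reg) false then (-1 : ℂ) else 1) *
      (phaseProd (innerChain ω ε) (List.ofFn x.2) * pathSgn (innerChain ω ε) (nextState (P, s, reg) false) (List.ofFn x.2))

include hω in
/-- The functionals are unimodular. -/
theorem norm_cVec (P : ZMod 3) (s : Bool) (reg : Fin (2 * r) → Bool) (hζ : ‖ζ‖ = 1) (x : Bool × (Fin (2 * r) → Bool)) :
    ‖cVec ζ ω ε P s reg x‖ = 1 := by
  unfold cVec
  have hΦ := norm_phaseProd (innerChain ω ε) (innerChain_unimodular hω ε) (List.ofFn x.2)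
  by_cases h : x.1 = s
  · rw [if_pos h, norm_mul, norm_mul, norm_mul, hζ, norm_sgn, hΦ, norm_pathSgn]; norm_num
  · rw [if_neg h, norm_mul, norm_mul, norm_sgn, hΦ, norm_pathSgn]; norm_num

/-- **The block operator at `(P, s, reg)` is the functional `cVec` of the common vector `gVec`.** -/
theorem blockOpR_eq_sum_cVec (P : ZMod 3) (s : Bool) (reg : Fin (2 * r) → Bool) :
    blockOpR ζ ω ε f (P, s, reg) = (1 / 2 : ℂ) ^ (2 * r + 1) * ∑ x : Bool × (Fin (2 * r) → Bool), cVec ζ ω ε P s reg x * gVec f P x := by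
  rw [blockOpR_apply, chainOp_eq_sum' (innerChain ω ε) (length_innerChain ω ε),
    chainOp_eq_sum' (innerChain ω ε) (length_innerChain ω ε), Fintype.sum_prod_type, Fintype.sum_bool]
  -- the end states: register flushed
  have hT : ∀ w : Fin (2 * r) → Bool, run (nextState ((P, s, reg) : RegState r) true) (List.ofFn w) =
      run ((P + spinZ s, s, fun _ => false) : RegState r) (List.ofFn w) := by
    intro w
    have e : nextState ((P, s, reg) : RegState r) true = (P + spinZ s, s, shiftIn reg true) := by simp [nextState]
    rw [e]; exact run_reg_irrel _ _ _ _ _ (by simp)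
  have hF : ∀ w : Fin (2 * r) → Bool, run (nextState ((P, s, reg) : RegState r) false) (List.ofFn w) =
      run ((P + spinZ (!s), !s, fun _ => false) : RegState r) (List.ofFn w) := by
    intro w
    have e : nextState ((P, s, reg) : RegState r) false = (P + spinZ (!s), !s, shiftIn reg false) := by simp [nextState]
    rw [e]; exact run_reg_irrel _ _ _ _ _ (by simp)
  simp only [cVec, gVec, hT, hF]
  cases s
  · simp only [Bool.true_eq_false, if_false, Bool.not_false, if_true]
    simp only [Finset.mul_sum, ← Finset.sum_add_distrib, Finset.sum_div]
    refine Finset.sum_congr rfl fun w _ => ?_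
    rw [pow_succ]; ring
  · simp only [if_true, Bool.false_eq_true, if_false, Bool.not_true]
    simp only [Finset.mul_sum, ← Finset.sum_add_distrib, Finset.sum_div]
    refine Finset.sum_congr rfl fun w _ => ?_
    rw [pow_succ]; ring

include hζ3 hζ1 hω in
/-- **The Gram product of the pair is `ζA + ζ̄B` with real `|A|, |B| ≤ 4^r`**, hence `≤ √3·4^r` in norm. -/
theorem norm_gram_pair_le (P : ZMod 3) (reg : Fin (2 * r) → Bool) :
    ‖∑ x : Bool × (Fin (2 * r) → Bool), cVec ζ ω ε P true reg x * conj (cVec ζ ω ε P false reg x)‖ ≤ Real.sqrt 3 * (4 : ℝ) ^ r := by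
  classical
  obtain ⟨_, hconj⟩ := cube_root_facts hζ3 hζ1
  set L := innerChain ω ε with hL
  have hΦsq : ∀ w : Fin (2 * r) → Bool, phaseProd L (List.ofFn w) * conj (phaseProd L (List.ofFn w)) = 1 := by
    intro w
    rw [Complex.mul_conj, Complex.normSq_eq_norm_sq, norm_phaseProd L (innerChain_unimodular hω ε)]
    norm_num
  -- the sign products: real `±1`
  set θ1 : (Fin (2 * r) → Bool) → ℂ := fun w =>
    (if ε 0 (P, true, reg) true then (-1 : ℂ) else 1) * pathSgn L (nextState (P, true, reg) true) (List.ofFn w) *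
      ((if ε 0 (P, false, reg) false then (-1 : ℂ) else 1) * pathSgn L (nextState (P, false, reg) false) (List.ofFn w)) with hθ1
  set θ0 : (Fin (2 * r) → Bool) → ℂ := fun w =>
    (if ε 0 (P, true, reg) false then (-1 : ℂ) else 1) * pathSgn L (nextState (P, true, reg) false) (List.ofFn w) *
      ((if ε 0 (P, false, reg) true then (-1 : ℂ) else 1) * pathSgn L (nextState (P, false, reg) true) (List.ofFn w)) with hθ0
  have hpm1 : ∀ w, θ1 w = 1 ∨ θ1 w = -1 := fun w =>
    pm_mul (pm_mul (sgn_cases _) (pathSgn_pm _ _ _)) (pm_mul (sgn_cases _) (pathSgn_pm _ _ _))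
  have hpm0 : ∀ w, θ0 w = 1 ∨ θ0 w = -1 := fun w =>
    pm_mul (pm_mul (sgn_cases _) (pathSgn_pm _ _ _)) (pm_mul (sgn_cases _) (pathSgn_pm _ _ _))
  -- conj of a `±1` or of a sign is itself
  have conj_pm : ∀ z : ℂ, (z = 1 ∨ z = -1) → conj z = z := by
    rintro z (rfl | rfl) <;> simp
  -- the termwise identity
  have hterm : ∀ x : Bool × (Fin (2 * r) → Bool), cVec ζ ω ε P true reg x * conj (cVec ζ ω ε P false reg x) =
      if x.1 then ζ * θ1 x.2 else conj ζ * θ0 x.2 := by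
    rintro ⟨b, w⟩
    cases b
    · simp only [cVec, Bool.false_eq_true, if_false, if_true, hL.symm]
      rw [map_mul, map_mul, map_mul, conj_pm _ (sgn_cases _), conj_pm _ (pathSgn_pm _ _ _)]
      have := hΦsq w
      simp only [hθ0]
      linear_combination ((if ε 0 (P, true, reg) false then (-1 : ℂ) else 1) * pathSgn L (nextState (P, true, reg) false) (List.ofFn w) *
        (conj ζ * ((if ε 0 (P, false, reg) true then (-1 : ℂ) else 1) * pathSgn L (nextState (P, false, reg) true) (List.ofFn w)))) * this
    · simp only [cVec, if_true, Bool.true_eq_false, if_false, hL.symm]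
      rw [map_mul, map_mul, conj_pm _ (sgn_cases _), conj_pm _ (pathSgn_pm _ _ _)]
      have := hΦsq w
      simp only [hθ1]
      linear_combination (ζ * (if ε 0 (P, true, reg) true then (-1 : ℂ) else 1) * pathSgn L (nextState (P, true, reg) true) (List.ofFn w) *
        ((if ε 0 (P, false, reg) false then (-1 : ℂ) else 1) * pathSgn L (nextState (P, false, reg) false) (List.ofFn w))) * this
  rw [Finset.sum_congr rfl fun x _ => hterm x, Fintype.sum_prod_type, Fintype.sum_bool]
  simp only [if_true, Bool.false_eq_true, if_false, ← Finset.mul_sum]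
  -- real parts: `θ = (θ.re : ℂ)`
  have hreal : ∀ z : ℂ, (z = 1 ∨ z = -1) → z = ((z.re : ℝ) : ℂ) := by
    rintro z (rfl | rfl) <;> simp
  have hA : ∑ w, θ1 w = (((∑ w, (θ1 w).re) : ℝ) : ℂ) := by
    push_cast; exact Finset.sum_congr rfl fun w _ => hreal _ (hpm1 w)
  have hB : ∑ w, θ0 w = (((∑ w, (θ0 w).re) : ℝ) : ℂ) := by
    push_cast; exact Finset.sum_congr rfl fun w _ => hreal _ (hpm0 w)
  rw [hA, hB]
  have hcard : (Fintype.card (Fin (2 * r) → Bool) : ℝ) = (4 : ℝ) ^ r := by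
    rw [Fintype.card_fun, Fintype.card_bool, Fintype.card_fin, pow_mul]; norm_num
  have hre1 : ∀ w, (θ1 w).re = 1 ∨ (θ1 w).re = -1 := fun w => by rcases hpm1 w with e | e <;> rw [e] <;> simp
  have hre0 : ∀ w, (θ0 w).re = 1 ∨ (θ0 w).re = -1 := fun w => by rcases hpm0 w with e | e <;> rw [e] <;> simp
  refine norm_zeta_real_combo hζ3 hζ1 _ _ _ (by positivity) ?_ ?_
  · rw [← hcard]; exact abs_sum_pm_le _ hre1
  · rw [← hcard]; exact abs_sum_pm_le _ hre0

include hζ3 hζ1 hω in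
/-- **PAIR ESTIMATE**: `‖(Tf)(P,⊤,reg)‖² + ‖(Tf)(P,⊥,reg)‖² ≤ 4^{−(2r+1)}·(2 + √3)·4^r·Σ_x ‖g(x)‖²`. -/
theorem pair_bound (P : ZMod 3) (reg : Fin (2 * r) → Bool) :
    ‖blockOpR ζ ω ε f (P, true, reg)‖ ^ 2 + ‖blockOpR ζ ω ε f (P, false, reg)‖ ^ 2 ≤
      (1 / 4 : ℝ) ^ (2 * r + 1) * ((2 + Real.sqrt 3) * (4 : ℝ) ^ r) * ∑ x : Bool × (Fin (2 * r) → Bool), ‖gVec f P x‖ ^ 2 := by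
  have hζn : ‖ζ‖ = 1 := norm_eq_one_of_cube hζ3
  rw [blockOpR_eq_sum_cVec ε f P true reg, blockOpR_eq_sum_cVec ε f P false reg, norm_mul, norm_mul, mul_pow, mul_pow, norm_pow,
    ← mul_add]
  have hhalf : ‖(1 / 2 : ℂ)‖ ^ (2 * r + 1) = ((1 / 2 : ℝ) ^ (2 * r + 1)) := by simp
  rw [hhalf]
  have hgram := gram_two (cVec ζ ω ε P true reg) (cVec ζ ω ε P false reg) (gVec f P)
    (norm_cVec hω ε P true reg hζn) (norm_cVec hω ε P false reg hζn)
  have hcard : (Fintype.card (Bool × (Fin (2 * r) → Bool)) : ℝ) = 2 * (4 : ℝ) ^ r := by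
    rw [Fintype.card_prod, Fintype.card_bool, Fintype.card_fun, Fintype.card_bool, Fintype.card_fin, pow_mul]; norm_num
  rw [hcard] at hgram
  have hγ := norm_gram_pair_le hζ3 hζ1 hω ε P reg
  have hG0 : 0 ≤ ∑ x : Bool × (Fin (2 * r) → Bool), ‖gVec f P x‖ ^ 2 := by positivity
  have e4 : ((1 / 2 : ℝ) ^ (2 * r + 1)) ^ 2 = (1 / 4 : ℝ) ^ (2 * r + 1) := by rw [← pow_mul, mul_comm, pow_mul]; norm_num
  calc ((1 / 2 : ℝ) ^ (2 * r + 1)) ^ 2 *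
        (‖∑ x, cVec ζ ω ε P true reg x * gVec f P x‖ ^ 2 + ‖∑ x, cVec ζ ω ε P false reg x * gVec f P x‖ ^ 2)
      ≤ ((1 / 2 : ℝ) ^ (2 * r + 1)) ^ 2 * ((2 * (4 : ℝ) ^ r +
          ‖∑ x, cVec ζ ω ε P true reg x * conj (cVec ζ ω ε P false reg x)‖) * ∑ x, ‖gVec f P x‖ ^ 2) :=
        mul_le_mul_of_nonneg_left hgram (by positivity)
    _ ≤ ((1 / 2 : ℝ) ^ (2 * r + 1)) ^ 2 * ((2 * (4 : ℝ) ^ r + Real.sqrt 3 * (4 : ℝ) ^ r) * ∑ x, ‖gVec f P x‖ ^ 2) := by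
        gcongr
    _ = (1 / 4 : ℝ) ^ (2 * r + 1) * ((2 + Real.sqrt 3) * (4 : ℝ) ^ r) * ∑ x, ‖gVec f P x‖ ^ 2 := by rw [e4]; ring

end Pair

/-! ## Summation and the theorem -/

/-- Re-indexing the common vectors over `P`: `Σ_P Σ_x ‖g_P(x)‖² = ‖f‖²`. -/
theorem sum_gVec (f : RegState r → ℂ) :
    ∑ P : ZMod 3, ∑ x : Bool × (Fin (2 * r) → Bool), ‖gVec f P x‖ ^ 2 = rnsq f := by
  unfold gVec rnsq
  rw [← Fintype.sum_prod_type']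
  -- shift `P ↦ P + spinZ b`
  let sh : ZMod 3 × (Bool × (Fin (2 * r) → Bool)) ≃ ZMod 3 × (Bool × (Fin (2 * r) → Bool)) :=
    { toFun := fun y => (y.1 + spinZ y.2.1, y.2)
      invFun := fun y => (y.1 - spinZ y.2.1, y.2)
      left_inv := fun y => by simp
      right_inv := fun y => by simp }
  rw [← sum_run_eq (fun _ => false) (fun τ => ‖f τ‖ ^ 2)]
  exact Equiv.sum_comp sh (fun y : ZMod 3 × (Bool × (Fin (2 * r) → Bool)) =>
    ‖f (run ((y.1, y.2.1, fun _ => false) : RegState r) (List.ofFn y.2.2))‖ ^ 2)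

/-- **`blockNormUniform3 : BlockNormUniform3` — PROVED**: `‖T_block f‖² ≤ (2+√3)/4 · ‖f‖²`, uniformly in the radius. -/
theorem blockNormUniform3 : BlockNormUniform3 := by
  intro r ζ hζ3 hζ1 ω hω ε f
  -- `rnsq (Tf) = Σ_P Σ_reg (‖Tf(P,⊤,reg)‖² + ‖Tf(P,⊥,reg)‖²)`
  have hsplit : rnsq (blockOpR ζ ω ε f) = ∑ P : ZMod 3, ∑ reg : Fin (2 * r) → Bool,
      (‖blockOpR ζ ω ε f (P, true, reg)‖ ^ 2 + ‖blockOpR ζ ω ε f (P, false, reg)‖ ^ 2) := by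
    unfold rnsq
    rw [Fintype.sum_prod_type]
    refine Finset.sum_congr rfl fun P _ => ?_
    rw [Fintype.sum_prod_type, Fintype.sum_bool, ← Finset.sum_add_distrib]
  rw [hsplit]
  have hpair := fun P reg => pair_bound hζ3 hζ1 hω ε f P reg
  calc ∑ P : ZMod 3, ∑ reg : Fin (2 * r) → Bool,
        (‖blockOpR ζ ω ε f (P, true, reg)‖ ^ 2 + ‖blockOpR ζ ω ε f (P, false, reg)‖ ^ 2)
      ≤ ∑ P : ZMod 3, ∑ _reg : Fin (2 * r) → Bool,
          (1 / 4 : ℝ) ^ (2 * r + 1) * ((2 + Real.sqrt 3) * (4 : ℝ) ^ r) * ∑ x : Bool × (Fin (2 * r) → Bool), ‖gVec f P x‖ ^ 2 :=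
        Finset.sum_le_sum fun P _ => Finset.sum_le_sum fun reg _ => hpair P reg
    _ = (1 / 4 : ℝ) ^ (2 * r + 1) * ((2 + Real.sqrt 3) * (4 : ℝ) ^ r) * (4 : ℝ) ^ r *
          ∑ P : ZMod 3, ∑ x : Bool × (Fin (2 * r) → Bool), ‖gVec f P x‖ ^ 2 := by
        rw [Finset.mul_sum]
        refine Finset.sum_congr rfl fun P _ => ?_
        rw [Finset.sum_const, Finset.card_univ, Fintype.card_fun, Fintype.card_bool, Fintype.card_fin, nsmul_eq_mul]
        push_cast
        rw [pow_mul]; norm_num; ring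
    _ = ((2 + Real.sqrt 3) / 4) * rnsq f := by
        rw [sum_gVec]
        have e16 : (1 / 4 : ℝ) ^ (2 * r + 1) * (4 : ℝ) ^ r * (4 : ℝ) ^ r = 1 / 4 := by
          have h1 : (1 / 4 : ℝ) ^ r * (4 : ℝ) ^ r = 1 := by rw [← mul_pow]; norm_num
          calc (1 / 4 : ℝ) ^ (2 * r + 1) * (4 : ℝ) ^ r * (4 : ℝ) ^ r = (1 / 4) * ((1 / 4 : ℝ) ^ r * (4 : ℝ) ^ r) ^ 2 := by ring
            _ = 1 / 4 := by rw [h1]; norm_num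
        calc (1 / 4 : ℝ) ^ (2 * r + 1) * ((2 + Real.sqrt 3) * (4 : ℝ) ^ r) * (4 : ℝ) ^ r * rnsq f
            = ((1 / 4 : ℝ) ^ (2 * r + 1) * (4 : ℝ) ^ r * (4 : ℝ) ^ r) * (2 + Real.sqrt 3) * rnsq f := by ring
          _ = ((2 + Real.sqrt 3) / 4) * rnsq f := by rw [e16]; ring

end BondTwist3

end Summit.QuantumAdvantage.AdviceFreeQNC0

end
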